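/-
Copyright (c) 2026 the pub-hodgecm-mathlib formalisation cell (harness21).  Prover seat hodgecm-mathlib-K2Liu-p05 (g3), 2026-09-04
(Track B «K2-LIT», crux hLiu418 = stmt-HodgeConjecture-24832, socket #42F′ `sig_K2LiuFirstTermIdentityOnGenerators`, ROAD I v3, organ G2-Weil,
sub-organ (G2-W2): smoothness of an archimedean Weil datum along `U(2,2)` and the letter derivatives; LEAD F0P6-plan (g12) GO 2026-09-04T06:47:18Z).
-/
import Summits.HodgeConjecture.HodgeConjecture.Theorems.K2LiuU22AdaptedBasis                 -- (G2-W1): `u22AdaptedBasis`, `expMem_smul_u22AdaptedBasis`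
import Literature.RepresentationTheory.KonnoKonno2007.JunctionArchDifferentiable             -- ★ engine `contDiffAt_apply_of_letters` + the U(2,1) template
import HarnessLib

/-!
# (G2-W2) Smoothness of an archimedean Weil datum along `U(2,2)`, and the derivatives of its one-parameter letters

Track B ∕ K2-LIT, hLiu418 = stmt-HodgeConjecture-24832, #42F′ ROAD I v3 organ G2-Weil (SIGS-RoadI-v3 §G2, (G2.2)), sub-organ (G2-W2): the `U(2,2)` TWIN
of ★ `KonnoKonno2007.JunctionArchDifferentiable` §§2–3.  Namespace `Summit.HodgeConjecture.HodgeConjecture.Cruxes.HLiu418.K2LiuWeilDatumSmoothU22`.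
DEFINITION (`u22LetterOp`, the smooth letters — review lane) + theorems; no instance, no notation, no named fact, no `sorry`; the Mathlib idiom
`attribute [local instance 100] LieRing.ofAssociativeRing` (as ★ `RealMatrixGroups`, ★ `JunctionArchDifferentiable`) to name `(uFormGroup (Fin 2) (Fin 2)).lie`;
`--supports stmt-HodgeConjecture-24832 --as helper`.

Let `ω` be an archimedean Weil datum (★ `IsArchWeilDatum (ι𝕎 (Fin 2) (Fin 2) R S) ω`, [Folland1989, §4.2]) of the real unitary dual pair
`G_∞ = U(2,2) × U(R,S)` (★ `RealDualPair.Ginf (Fin 2) (Fin 2) R S`) on `𝓢 = 𝓢(ℝ^{DPIdx}, ℂ)`, whose maximal compact acts on the vacuum by the scalar `vacScalar e`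
(the vacuum clause `hvac` of ★ `JunctionDegreeOneKTypes`; `(R, S) = (3, 0)` is the totally definite `V′_σ` of #42F′, `(1, 0)` the line).

* §1 LETTERS: `u22LetterOp e k kind` — the smooth letter (★ `SmoothLetter`) `κOp e (k,1) ∘ L(s) ∘ κOp e (k⁻¹,1)` of a framed generator (`L = hypOp p q` ∕
  `torusKOp e a b`, ★ `isSmoothOneParam_hypOp` ∕ ★ `isSmoothOneParam_torusKOp`), and **`weilDatum_apply_conj_letterOf`**: `ω (k L(s) k⁻¹, 1) = (u22LetterOp e k kind).op s`
  (★ `weilDatum_apply_κ_eq_κOp`, ★ `weilDatum_apply_hypV_eq_hypOp`, ★ `weilDatum_apply_κ_torusK` — all general in `P Q R S`).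
* §2 **`contDiffAt_weilDatum_inl`** — for every `c : B → U(2,2)` which is `C^∞` at `x₀` as a matrix-valued map, every continuous ℝ-linear `T : 𝓢 → V` into a
  normed space and every `Φ ∈ 𝓢`, `x ↦ T (ω (c x, 1) Φ)` is `C^∞` at `x₀` (★ `RealMatrixGroup.contDiffAt_apply_of_letters` at ★ `u22AdaptedBasis` ∕
  ★ `expMem_smul_u22AdaptedBasis`; [Varadarajan1984, Thm. 2.10.1]).
* §3 THE (G2.2) FACE ALONG THE SIXTEEN BASIS DIRECTIONS: **`hasDerivAt_weilDatum_expMem_smul_u22X`** —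
  `HasDerivAt (fun s => T (ω (expMem (s • X_i), 1) Φ)) (T (dω_i Φ)) 0` with the EXPLICIT Schwartz vector
  `dω_i Φ = κOp e (k_i,1) (G_i (κOp e (k_i⁻¹,1) Φ))` (`G_i` = ★ `hypOpGenC p q` ∕ ★ `torusKGen e a b`), i.e. `u22LetterDeriv`; and at every time `s`
  (`hasDerivAt_weilDatum_expMem_smul_u22X_at`).  These are the `hXφ`-producers G1.1 ∕ G2-PS (K2Liu-p08) consume BY VALUE, letter by letter; the derivative
  along a general `X = ∑ aᵢ X_i ∈ 𝔲(2,2)` (linearity in `X` through canonical coordinates of the second kind) is the sequel's.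
* THE HYPOTHESIS-FREE INSTANCE (sequel `K2LiuWeilRepPairSmoothU22.lean`): at the tree's CONSTRUCTED junction datum `ω = weilRep ∘ toBig` of
  `U(2,2) × U(R,S)` (★ `JunctionWeilDatumGeneralRank.isArchWeilDatum_weilRepPair`, vacuum exponents `(−|S|, −|R|, −2, −2)` by ★
  `weilRepPair_κ_hermitePi_zero` = KK Lemma 5.2) §2 and §3 hold WITH NO HYPOTHESIS — non-vacuity, and the datum the archimedean factorisation
  (★ `IsArchWeilDatum.exists_circle_twist_factorisation_clm`) twists by a circle character at the bridge (G2-W4).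

HONEST LABEL: HC_CM is proved only modulo the 7 printed citations (2 remaining named inputs: hLiu418 = stmt-HodgeConjecture-24832, h413 =
stmt-HodgeConjecture-24833) until rung 0 closes; organ capital (G2-W2) for #42F′'s Road I, moves no counter.

## References
* [Folland1989] G. B. Folland, *Harmonic Analysis in Phase Space* (1989), §4.2, (4.24), Prop. (4.39).
* [Varadarajan1984] V. S. Varadarajan, *Lie Groups, Lie Algebras, and Their Representations* (1984), Thm. 2.10.1, (2.10.19).
* [Knapp2002] A. W. Knapp, *Lie Groups Beyond an Introduction*, 2nd ed. (2002), I.§10, VI.§2.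
-/

set_option autoImplicit false
set_option linter.dupNamespace false

noncomputable section

open scoped MatrixGroups Matrix Topology SchwartzMap Matrix.Norms.Operator
open Filter
open Literature.NumberTheory.Automorphic Literature.Analysis.SegalBargmann Literature.NumberTheory.Weil1964
open Literature.RepresentationTheory.KonnoKonno2007 hiding LetterKind letterOf letterGen letterOf_boost letterOf_torus letterOf_torus_eq
  letterGen_boost letterGen_torus letterGen_mem_lie exp_smul_letterGen
open Literature.RepresentationTheory.KonnoKonno2007.RealDualPair
open Literature.RepresentationTheory.KonnoKonno2007.RealDualPair.UForm
open Summit.HodgeConjecture.HodgeConjecture.Cruxes.HLiu418.K2LiuU22AdaptedBasis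

-- Mathlib idiom (`Mathlib/Algebra/Lie/OfAssociative.lean`), as in ★ `RealMatrixGroups` ∕ ★ `JunctionArchDifferentiable`: the commutator bracket on
-- `Matrix n n ℂ`, needed to name the Lie subalgebra `(uFormGroup (Fin 2) (Fin 2)).lie`
attribute [local instance 100] LieRing.ofAssociativeRing

namespace Summit.HodgeConjecture.HodgeConjecture.Cruxes.HLiu418.K2LiuWeilDatumSmoothU22

/-! ## §1 The letters of `U(2,2)` under an archimedean Weil datum -/

section Letters

variable {R S : Type*} [Fintype R] [DecidableEq R] [Fintype S] [DecidableEq S]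

variable (R S) in
/-- **The smooth letter of a framed generator of `𝔲(2,2)`**: for a frame `k ∈ U(2) × U(2)` and a letter kind,
`boost p q ↦ (κOp e (k,1), hypOp p q, its generator, κOp e (k⁻¹,1))`, `torus a b ↦ (κOp e (k,1), torusKOp e a b, torusKGen e a b, κOp e (k⁻¹,1))`.
[cite: Folland1989, (4.24), Prop. (4.39)] -/
def u22LetterOp (e : VacExponents) (k : Matrix.unitaryGroup (Fin 2) ℂ × Matrix.unitaryGroup (Fin 2) ℂ) :
    LetterKind → SmoothLetter (DPIdx (Fin 2) (Fin 2) R S → ℝ)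
  | .boost p q => ⟨κOp R S e (k, 1), hypOp R S p q, hypOpGenC R S p q, κOp R S e (k⁻¹, 1), isSmoothOneParam_hypOp R S p q⟩
  | .torus a b => ⟨κOp R S e (k, 1), torusKOp R S e a b, torusKGen R S e a b, κOp R S e (k⁻¹, 1), isSmoothOneParam_torusKOp e a b⟩

/-- The operator of a boost letter: `κOp e (k,1) ∘ hypOp p q s ∘ κOp e (k⁻¹,1)`. [folklore] -/
@[simp] theorem u22LetterOp_boost_op (e : VacExponents) (k : Matrix.unitaryGroup (Fin 2) ℂ × Matrix.unitaryGroup (Fin 2) ℂ) (p q : Fin 2) (s : ℝ)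
    (f : SchwartzMap (DPIdx (Fin 2) (Fin 2) R S → ℝ) ℂ) :
    (u22LetterOp R S e k (.boost p q)).op s f = κOp R S e (k, 1) (hypOp R S p q s (κOp R S e (k⁻¹, 1) f)) := rfl

/-- The operator of a torus letter: `κOp e (k,1) ∘ torusKOp e a b s ∘ κOp e (k⁻¹,1)`. [folklore] -/
@[simp] theorem u22LetterOp_torus_op (e : VacExponents) (k : Matrix.unitaryGroup (Fin 2) ℂ × Matrix.unitaryGroup (Fin 2) ℂ) (a b : Fin 2 → ℝ) (s : ℝ)
    (f : SchwartzMap (DPIdx (Fin 2) (Fin 2) R S → ℝ) ℂ) :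
    (u22LetterOp R S e k (.torus a b)).op s f = κOp R S e (k, 1) (torusKOp R S e a b s (κOp R S e (k⁻¹, 1) f)) := rfl

/-- The DERIVED operator of a boost letter at time `s`: `κOp e (k,1) (hypOp p q s (hypOpGenC p q (κOp e (k⁻¹,1) f)))`. [folklore] -/
@[simp] theorem u22LetterOp_boost_deriv_op (e : VacExponents) (k : Matrix.unitaryGroup (Fin 2) ℂ × Matrix.unitaryGroup (Fin 2) ℂ) (p q : Fin 2)
    (s : ℝ) (f : SchwartzMap (DPIdx (Fin 2) (Fin 2) R S → ℝ) ℂ) :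
    (u22LetterOp R S e k (.boost p q)).deriv.op s f = κOp R S e (k, 1) (hypOp R S p q s (hypOpGenC R S p q (κOp R S e (k⁻¹, 1) f))) := rfl

/-- The DERIVED operator of a torus letter at time `s`. [folklore] -/
@[simp] theorem u22LetterOp_torus_deriv_op (e : VacExponents) (k : Matrix.unitaryGroup (Fin 2) ℂ × Matrix.unitaryGroup (Fin 2) ℂ) (a b : Fin 2 → ℝ)
    (s : ℝ) (f : SchwartzMap (DPIdx (Fin 2) (Fin 2) R S → ℝ) ℂ) :
    (u22LetterOp R S e k (.torus a b)).deriv.op s f = κOp R S e (k, 1) (torusKOp R S e a b s (torusKGen R S e a b (κOp R S e (k⁻¹, 1) f))) := rfl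

/-- **A conjugated letter acts by its smooth letter**: for an archimedean Weil datum of `U(2,2) × U(R,S)` with vacuum clause,
`ω (k L(s) k⁻¹, 1) f = (u22LetterOp e k kind).op s f` for `k = kV (frame)` and `L = letterOf kind`. [cite: Folland1989, (4.24), Prop. (4.39)] -/
theorem weilDatum_apply_conj_letterOf {ω : Representation ℂ (Ginf (Fin 2) (Fin 2) R S) (SchwartzMap (DPIdx (Fin 2) (Fin 2) R S → ℝ) ℂ)}
    (hW : IsArchWeilDatum (ι𝕎 (Fin 2) (Fin 2) R S) ω) {e : VacExponents}
    (hvac : ∀ k : DPK (Fin 2) (Fin 2) R S, ω (κ (Fin 2) (Fin 2) R S k) (hermitePi 0) = vacScalar e k • hermitePi 0)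
    (k : Matrix.unitaryGroup (Fin 2) ℂ × Matrix.unitaryGroup (Fin 2) ℂ) (kd : LetterKind) (s : ℝ) (f : SchwartzMap (DPIdx (Fin 2) (Fin 2) R S → ℝ) ℂ) :
    ω ((kV (Fin 2) (Fin 2) k * letterOf kd s * (kV (Fin 2) (Fin 2) k)⁻¹, (1 : UForm R S)) : Ginf (Fin 2) (Fin 2) R S) f =
      (u22LetterOp R S e k kd).op s f := by
  have hk2 : κ (Fin 2) (Fin 2) R S (k⁻¹, 1) = (((kV (Fin 2) (Fin 2) k)⁻¹, (1 : UForm R S)) : Ginf (Fin 2) (Fin 2) R S) :=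
    Prod.ext (map_inv (kV (Fin 2) (Fin 2)) k) (map_one (kV R S))
  have h1 : ((kV (Fin 2) (Fin 2) k * letterOf kd s * (kV (Fin 2) (Fin 2) k)⁻¹, (1 : UForm R S)) : Ginf (Fin 2) (Fin 2) R S) =
      κ (Fin 2) (Fin 2) R S (k, 1) * ((letterOf kd s, (1 : UForm R S)) : Ginf (Fin 2) (Fin 2) R S) * κ (Fin 2) (Fin 2) R S (k⁻¹, 1) := by
    rw [κ_mk_one, hk2, Prod.mk_mul_mk, Prod.mk_mul_mk, mul_one, mul_one]
  rw [h1, map_mul, map_mul, Module.End.mul_apply, Module.End.mul_apply, weilDatum_apply_κ_eq_κOp hW hvac (k⁻¹, 1) f,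
    weilDatum_apply_κ_eq_κOp hW hvac (k, 1)]
  cases kd with
  | boost p q =>
    rw [u22LetterOp_boost_op, letterOf_boost, weilDatum_apply_hypV_eq_hypOp hW p q s]
  | torus a b =>
    have h2 : ((letterOf (.torus a b) s, (1 : UForm R S)) : Ginf (Fin 2) (Fin 2) R S) = κ (Fin 2) (Fin 2) R S (torusK R S a b s) :=
      Prod.ext rfl (map_one (kV R S)).symm
    rw [u22LetterOp_torus_op, h2, weilDatum_apply_κ_torusK hW hvac a b s]

end Letters

/-! ## §2 Smoothness of an archimedean Weil datum along `U(2,2)` -/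

section Main

variable {R S : Type*} [Fintype R] [DecidableEq R] [Fintype S] [DecidableEq S]
  {V : Type*} [NormedAddCommGroup V] [NormedSpace ℝ V]

set_option backward.isDefEq.respectTransparency false in
/-- **Smoothness of an archimedean Weil datum along `U(2,2)`.**  For an archimedean Weil datum `ω` of `U(2,2) × U(R,S)` with vacuum clause, every
`c : B → U(2,2)` which is `C^∞` at `x₀` as a matrix-valued map, every continuous real-linear `T : 𝓢 → V` and every `Φ ∈ 𝓢`, the function `x ↦ T (ω (c x, 1) Φ)`
is `C^∞` at `x₀` — the engine ★ `RealMatrixGroup.contDiffAt_apply_of_letters` at the adapted basis of `𝔲(2,2)` ((G2-W1) ★ `u22AdaptedBasis`,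
★ `expMem_smul_u22AdaptedBasis`) and the letters of §1. [cite: Varadarajan1984, Thm. 2.10.1 and (2.10.19), p. 89] -/
theorem contDiffAt_weilDatum_inl {ω : Representation ℂ (Ginf (Fin 2) (Fin 2) R S) (SchwartzMap (DPIdx (Fin 2) (Fin 2) R S → ℝ) ℂ)}
    (hW : IsArchWeilDatum (ι𝕎 (Fin 2) (Fin 2) R S) ω) {e : VacExponents}
    (hvac : ∀ k : DPK (Fin 2) (Fin 2) R S, ω (κ (Fin 2) (Fin 2) R S k) (hermitePi 0) = vacScalar e k • hermitePi 0)
    {B : Type*} [NormedAddCommGroup B] [NormedSpace ℝ B] {c : B → UForm (Fin 2) (Fin 2)} {x₀ : B}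
    (hc : ContDiffAt ℝ ((⊤ : ℕ∞) : WithTop ℕ∞) (fun x => ((c x : GL (Fin 2 ⊕ Fin 2) ℂ) : Matrix (Fin 2 ⊕ Fin 2) (Fin 2 ⊕ Fin 2) ℂ)) x₀)
    (T : (SchwartzMap (DPIdx (Fin 2) (Fin 2) R S → ℝ) ℂ) →L[ℝ] V) (Φ : SchwartzMap (DPIdx (Fin 2) (Fin 2) R S → ℝ) ℂ) :
    ContDiffAt ℝ ((⊤ : ℕ∞) : WithTop ℕ∞) (fun x => T (ω ((c x, (1 : UForm R S)) : Ginf (Fin 2) (Fin 2) R S) Φ)) x₀ :=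
  (uFormGroup (Fin 2) (Fin 2)).contDiffAt_apply_of_letters uFormGroup_regular u22X u22AdaptedBasis coe_u22X_eq (inlRep R S ω)
    (fun i => u22LetterOp R S e (u22FrameK i) (u22Kind i))
    (fun i s f => by
      rw [expMem_smul_u22X]
      exact weilDatum_apply_conj_letterOf hW hvac (u22FrameK i) (u22Kind i) s f)
    hc T Φ

end Main

/-! ## §3 The (G2.2) face along the sixteen basis directions: derivatives of the letters -/

section Derivatives

variable {R S : Type*} [Fintype R] [DecidableEq R] [Fintype S] [DecidableEq S]
  {V : Type*} [NormedAddCommGroup V] [NormedSpace ℝ V]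

/-- **THE LETTER DERIVATIVE AT ANY TIME**: for an archimedean Weil datum of `U(2,2) × U(R,S)` with vacuum clause, along the one-parameter group
`s ↦ exp (s · X_i) = k_i L_i(s) k_i⁻¹` of the `i`-th adapted basis vector of `𝔲(2,2)`,
`d∕ds T (ω (exp (s X_i), 1) Φ) = T ((u22LetterOp e k_i kind_i).deriv.op s Φ)` — an explicit Schwartz vector
(`κOp (k_i,1) (L_i(s) (G_i (κOp (k_i⁻¹,1) Φ)))`, `G_i` = ★ `hypOpGenC` ∕ ★ `torusKGen`). [cite: Folland1989, (4.24), Prop. (4.39)] -/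
theorem hasDerivAt_weilDatum_expMem_smul_u22X_at {ω : Representation ℂ (Ginf (Fin 2) (Fin 2) R S) (SchwartzMap (DPIdx (Fin 2) (Fin 2) R S → ℝ) ℂ)}
    (hW : IsArchWeilDatum (ι𝕎 (Fin 2) (Fin 2) R S) ω) {e : VacExponents}
    (hvac : ∀ k : DPK (Fin 2) (Fin 2) R S, ω (κ (Fin 2) (Fin 2) R S k) (hermitePi 0) = vacScalar e k • hermitePi 0)
    (i : Fin 16) (T : (SchwartzMap (DPIdx (Fin 2) (Fin 2) R S → ℝ) ℂ) →L[ℝ] V) (Φ : SchwartzMap (DPIdx (Fin 2) (Fin 2) R S → ℝ) ℂ) (s₀ : ℝ) :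
    HasDerivAt (fun s => T (ω ((((uFormGroup (Fin 2) (Fin 2)).expMem (s • u22X i) : UForm (Fin 2) (Fin 2)), (1 : UForm R S)) :
        Ginf (Fin 2) (Fin 2) R S) Φ))
      (T ((u22LetterOp R S e (u22FrameK i) (u22Kind i)).deriv.op s₀ Φ)) s₀ := by
  have h := (u22LetterOp R S e (u22FrameK i) (u22Kind i)).hasDerivAt_op_apply T Φ s₀
  refine h.congr_of_eventuallyEq (Filter.Eventually.of_forall fun s => ?_)
  show T (ω _ Φ) = T ((u22LetterOp R S e (u22FrameK i) (u22Kind i)).op s Φ)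
  rw [expMem_smul_u22X]
  exact congrArg T (weilDatum_apply_conj_letterOf hW hvac (u22FrameK i) (u22Kind i) s Φ)

/-- **THE (G2.2) FACE AT `s = 0`**: `HasDerivAt (fun s => T (ω (exp (s X_i), 1) Φ)) (T (dω_i Φ)) 0` with the explicit Schwartz vector
`dω_i Φ = κOp e (k_i,1) (G_i (κOp e (k_i⁻¹,1) Φ))` (the letter family is the identity at `s = 0`: ★ `IsSmoothOneParam.map_zero`).
[cite: Folland1989, (4.24), Prop. (4.39)] -/
theorem hasDerivAt_weilDatum_expMem_smul_u22X {ω : Representation ℂ (Ginf (Fin 2) (Fin 2) R S) (SchwartzMap (DPIdx (Fin 2) (Fin 2) R S → ℝ) ℂ)}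
    (hW : IsArchWeilDatum (ι𝕎 (Fin 2) (Fin 2) R S) ω) {e : VacExponents}
    (hvac : ∀ k : DPK (Fin 2) (Fin 2) R S, ω (κ (Fin 2) (Fin 2) R S k) (hermitePi 0) = vacScalar e k • hermitePi 0)
    (i : Fin 16) (T : (SchwartzMap (DPIdx (Fin 2) (Fin 2) R S → ℝ) ℂ) →L[ℝ] V) (Φ : SchwartzMap (DPIdx (Fin 2) (Fin 2) R S → ℝ) ℂ) :
    HasDerivAt (fun s => T (ω ((((uFormGroup (Fin 2) (Fin 2)).expMem (s • u22X i) : UForm (Fin 2) (Fin 2)), (1 : UForm R S)) :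
        Ginf (Fin 2) (Fin 2) R S) Φ))
      (T ((u22LetterOp R S e (u22FrameK i) (u22Kind i)).pre
        ((u22LetterOp R S e (u22FrameK i) (u22Kind i)).gen ((u22LetterOp R S e (u22FrameK i) (u22Kind i)).post Φ)))) (0 : ℝ) := by
  have h := hasDerivAt_weilDatum_expMem_smul_u22X_at hW hvac i T Φ 0
  rwa [SmoothLetter.deriv_op_apply, (u22LetterOp R S e (u22FrameK i) (u22Kind i)).smooth.map_zero, ContinuousLinearMap.id_apply] at h

end Derivatives

end Summit.HodgeConjecture.HodgeConjecture.Cruxes.HLiu418.K2LiuWeilDatumSmoothU22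

end
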